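import Literature.Computability.Complexity.CodeFPArith
import Literature.Computability.Complexity.CodeFPLists
import Literature.Computability.Complexity.CodeFPOfUnary
import Literature.Computability.Complexity.TM2PassThrough
import HarnessLib

/-!
# Typed polynomial-time bricks for the Micciancio–Peikert machine: modular sums and dot products, counting, first argmax, chunking, fixed polynomials, `⌊log₂⌋ + 1`

Topic `Computability/Cryptography` (LWE), grouping namespace `LWE.MP12.Prog`; a small layer over
the typed algebra `CodeFP` (`Complexity/CodeFP.lean`, `CodeFPArith.lean`, `CodeFPLists.lean`,
`CodeFPOfUnary.lean`). Generic, proved material (no named fact) for the oracle machine of the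
search-to-decision reduction (`LWEPrimePowerProg*.lean`, towards
`blprs_gapSVP_sqrt_dim_to_lwe_classical`, **pqc.S21**), which is written on raw lists of
naturals (residues mod `Q` by their representatives) so that ONE string function serves every
dimension: the folds below are the places where the accumulator-growth hypothesis of
`CodeFP.foldl` is discharged once and for all.

* `sumMod` (`(Q, l) ↦ (∑ l) mod Q`, accumulator kept reduced; `sumMod_eq`), `dotMod`;
  `codeFP_countTrue`; `firstArgmax` (least index of a maximal entry; `firstArgmax_spec`);
  `chunks` (consecutive pieces of a given unary length; `chunks_eq`); `codeFP_polyEval` (a FIXED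
  polynomial with natural coefficients); `logSucc` (`max 1 |bin n| = ⌊log₂ n⌋ + 1`, `logSucc_eq`).

## References

* S. Arora, B. Barak, *Computational Complexity: A Modern Approach*, CUP 2009, §1.3 (polynomial
  time is closed under composition and polynomially bounded loops). [AroraBarak2009]
-/

namespace Literature.Computability.Cryptography

namespace LWE

namespace MP12

namespace Prog

open _root_.Computability Polynomial Literature.Computability.Complexity Literature.Computability.Complexity.CodeFP

/-! ### Modular sums -/

/-- The sum of a list reduced modulo `max Q 1` at every step (so `mod Q` for `Q ≥ 1`). [folklore] -/
def sumMod (Q : ℕ) (l : List ℕ) : ℕ := l.foldl (fun acc x => (acc + x) % max Q 1) 0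

/-- The reduced fold computes the reduced sum. [folklore] -/
theorem foldl_mod_eq (Q : ℕ) : ∀ (l : List ℕ) (acc : ℕ),
    l.foldl (fun acc x => (acc + x) % Q) (acc % Q) = (acc + l.sum) % Q
  | [], acc => by simp
  | x :: l, acc => by
    rw [List.foldl_cons, Nat.mod_add_mod, foldl_mod_eq Q l (acc + x), List.sum_cons, Nat.add_assoc]

/-- `sumMod Q l = (∑ l) mod Q` for `Q ≥ 1`. [folklore] -/
theorem sumMod_eq {Q : ℕ} (hQ : 1 ≤ Q) (l : List ℕ) : sumMod Q l = l.sum % Q := by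
  rw [sumMod, max_eq_left hQ]
  have h := foldl_mod_eq Q l 0
  rw [Nat.zero_mod, Nat.zero_add] at h
  exact h

/-- A reduced numeral is at most one longer than the modulus' numeral. [folklore] -/
theorem length_natE_mod_le (a Q : ℕ) : (natE (a % max Q 1)).length ≤ (natE Q).length + 1 := by
  rcases Nat.eq_zero_or_pos Q with rfl | hQ
  · rw [max_eq_right (Nat.zero_le 1), Nat.mod_one]
    change (encodeNat 0).length ≤ _
    simp
  · rw [max_eq_left hQ]
    have h : a % Q ≤ Q := (Nat.mod_lt a hQ).le
    have e1 := TM2Pass.length_encodeNat_eq_size (a % Q)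
    have e2 := TM2Pass.length_encodeNat_eq_size Q
    have := Nat.size_le_size h
    change (encodeNat (a % Q)).length ≤ (encodeNat Q).length + 1
    omega

/-- **Modular summation on codes.** [cite: AroraBarak2009, §1.3] -/
theorem codeFP_sumMod : CodeFP (pairE natE (rawE natE)) natE (fun p => sumMod p.1 p.2) := by
  have hstep : CodeFP (pairE natE (pairE natE natE)) natE (fun t => (t.2.2 + t.2.1) % max t.1 1) :=
    natMod.comp ((natAdd.comp ((snd _ _).snd'.pair (snd _ _).fst')).pair (natMax.comp ((fst _ _).pair (const _ 1))))
  refine (foldl (σ := ℕ) (α := ℕ) (β := ℕ) (eσ := natE) (eα := natE) (eβ := natE)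
    (step := fun Q x acc => (acc + x) % max Q 1) (init := fun _ => 0) hstep (const _ 0) (X + 1) fun Q l₁ l₂ => ?_).congr
    fun p => rfl
  rw [eval_add, eval_X, eval_one, pairE_apply, length_boolPair]
  have h : ∀ (l : List ℕ) (acc : ℕ), (natE acc).length ≤ (natE Q).length + 1 →
      (natE (l.foldl (fun acc x => (acc + x) % max Q 1) acc)).length ≤ (natE Q).length + 1 := by
    intro l
    induction l with
    | nil => intro acc h; exact h
    | cons x l ih => intro acc _; exact ih _ (length_natE_mod_le _ _)
  have h0 : (natE 0).length ≤ (natE Q).length + 1 := by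
    change (encodeNat 0).length ≤ _
    simp
  have := h l₁ 0 h0
  dsimp only
  omega

/-- The dot product of two lists reduced mod `max Q 1`. [folklore] -/
def dotMod (Q : ℕ) (u v : List ℕ) : ℕ := sumMod Q (List.zipWith (fun a b => a * b % max Q 1) u v)

/-- **Modular dot products on codes.** [cite: AroraBarak2009, §1.3] -/
theorem codeFP_dotMod : CodeFP (pairE natE (pairE (rawE natE) (rawE natE))) natE (fun p => dotMod p.1 p.2.1 p.2.2) := by
  have hz := zipWith (σ := ℕ) (eσ := natE) (eα := natE) (eβ := natE) (eγ := natE)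
    (g := fun t : ℕ × ℕ × ℕ => t.2.1 * t.2.2 % max t.1 1)
    (natMod.comp ((natMul.comp (snd _ _)).pair (natMax.comp ((fst _ _).pair (const _ 1)))))
  exact (codeFP_sumMod.comp ((fst _ _).pair hz)).congr fun p => rfl

/-- `dotMod Q u v = (∑ᵢ uᵢ vᵢ) mod Q` for `Q ≥ 1` (lists of equal length). [folklore] -/
theorem dotMod_eq {Q : ℕ} (hQ : 1 ≤ Q) (u v : List ℕ) :
    dotMod Q u v = (List.zipWith (· * ·) u v).sum % Q := by
  rw [dotMod, sumMod_eq hQ, max_eq_left hQ, List.sum_nat_mod, List.map_zipWith]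
  conv_rhs => rw [List.sum_nat_mod, List.map_zipWith]
  simp

/-! ### Counting and the first argmax -/

/-- The number of `1`s of a bit list, as a left fold. [folklore] -/
def countTrue (l : List Bool) : ℕ := l.foldl (fun k b => if b then k + 1 else k) 0

/-- The counting fold adds the number of `1`s. [folklore] -/
theorem foldl_count_eq : ∀ (l : List Bool) (k : ℕ), l.foldl (fun k b => if b then k + 1 else k) k = k + l.count true
  | [], k => by simp
  | b :: l, k => by
    rw [List.foldl_cons, foldl_count_eq l, List.count_cons]
    cases b <;> simp; omega

/-- `countTrue l` is the number of `1`s. [folklore] -/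
theorem countTrue_eq (l : List Bool) : countTrue l = l.count true := by
  rw [countTrue, foldl_count_eq, Nat.zero_add]

/-- `countTrue l ≤ |l|`. [folklore] -/
theorem countTrue_le (l : List Bool) : countTrue l ≤ l.length := by
  rw [countTrue_eq]
  exact List.count_le_length

/-- **Counting the `1`s of a bit list on codes** (binary result). [cite: AroraBarak2009, §1.3] -/
theorem codeFP_countTrue : CodeFP (rawE bitE) natE countTrue := by
  have hstep : CodeFP (pairE bitE natE) natE (fun t => if t.1 then t.2 + 1 else t.2) :=
    (fst _ _).ite (natAdd.comp ((snd _ _).pair (const _ 1))) (snd _ _)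
  refine (foldl₀ (step := fun (b : Bool) (k : ℕ) => if b then k + 1 else k) (b₀ := 0) hstep X fun l₁ l₂ => ?_).congr
    fun l => rfl
  rw [eval_X]
  refine (length_natE_le _).trans ((countTrue_le l₁).trans ?_)
  exact (length_le_length_rawE bitE l₁).trans (length_rawE_le_of_sublist bitE (List.sublist_append_left l₁ l₂))

/-- **The least index of a maximal entry** (`0` on the empty list): a left fold over the enumerated list
keeping the first strict improvement. [folklore] -/
def firstArgmax (l : List ℕ) : ℕ :=
  (((List.range l.length).zip l).foldl (fun (acc : ℕ × ℕ) (q : ℕ × ℕ) => if decide (acc.2 < q.2) then q else acc) (0, 0)).1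

/-- **The first argmax on codes.** [cite: AroraBarak2009, §1.3] -/
theorem codeFP_firstArgmax : CodeFP (rawE natE) natE firstArgmax := by
  have hstep : CodeFP (pairE (pairE natE natE) (pairE natE natE)) (pairE natE natE)
      (fun t => if decide (t.2.2 < t.1.2) then t.1 else t.2) :=
    (natLt.comp ((snd _ _).snd'.pair (fst _ _).snd')).ite (fst _ _) (snd _ _)
  have hfold := foldl₀ (eα := pairE natE natE) (eβ := pairE natE natE)
    (step := fun (q : ℕ × ℕ) (acc : ℕ × ℕ) => if decide (acc.2 < q.2) then q else acc) (b₀ := (0, 0)) hstep (X + 8) (fun l₁ l₂ => by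
      rw [eval_add, eval_X, eval_ofNat]
      -- the accumulator is `(0, 0)` or an item of `l₁`
      have h : ∀ (l : List (ℕ × ℕ)) (acc : ℕ × ℕ), (acc ∈ l₁ ++ l₂ ∨ acc = (0, 0)) → l ⊆ l₁ ++ l₂ →
          (l.foldl (fun acc q => if decide (acc.2 < q.2) then q else acc) acc ∈ l₁ ++ l₂ ∨
            l.foldl (fun acc q => if decide (acc.2 < q.2) then q else acc) acc = (0, 0)) := by
        intro l
        induction l with
        | nil => intro acc h _; exact h
        | cons q l ih =>
          intro acc h hsub
          rw [List.foldl_cons]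
          refine ih _ ?_ fun x hx => hsub (by simp [hx])
          split_ifs
          · exact Or.inl (hsub (by simp))
          · exact h
      rcases h l₁ (0, 0) (Or.inr rfl) (by simp) with h | h
      · have := length_item_le_length_rawE (pairE natE natE) h
        omega
      · rw [h]
        change (boolPair (encodeNat 0) (encodeNat 0)).length ≤ _
        simp [length_boolPair])
  exact (hfold.comp (rawEnum natE)).fst'.congr fun l => rfl


/-- The invariant of the argmax fold after a nonempty prefix. [folklore] -/
theorem firstArgmax_fold_inv (l : List ℕ) :
    ∀ (t : ℕ), 1 ≤ t → t ≤ l.length →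
      let acc := (((List.range t).zip (l.take t)).foldl
        (fun (acc : ℕ × ℕ) (q : ℕ × ℕ) => if decide (acc.2 < q.2) then q else acc) (0, 0))
      acc.1 < t ∧ acc.2 = l.getD acc.1 0 ∧ (∀ i < t, l.getD i 0 ≤ acc.2) ∧ (∀ i < acc.1, l.getD i 0 < acc.2) := by
  intro t ht htl
  induction t with
  | zero => omega
  | succ t ih =>
    simp only
    rw [List.range_succ, List.take_add_one, List.getElem?_eq_getElem (by omega), Option.toList_some,
      List.zip_append (by simp; omega), List.foldl_append]
    simp only [List.zip_cons_cons, List.zip_nil_right, List.foldl_cons, List.foldl_nil]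
    rcases Nat.eq_zero_or_pos t with rfl | ht0
    · -- the first step
      simp only [List.range_zero, List.take_zero, List.zip_nil_right, List.foldl_nil]
      have e0 : l.getD 0 0 = l[0]'(by omega) := List.getD_eq_getElem _ _ _
      by_cases h0 : (0 : ℕ) < l[0]'(by omega)
      · rw [if_pos (decide_eq_true h0)]
        refine ⟨Nat.lt_succ_self 0, e0.symm, fun i hi => ?_, fun i hi => absurd hi (Nat.not_lt_zero _)⟩
        have : i = 0 := by omega
        subst this
        exact e0.le
      · rw [if_neg (by simpa using h0)]
        have hz : l[0]'(by omega) = 0 := by omega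
        refine ⟨Nat.lt_succ_self 0, by rw [e0, hz], fun i hi => ?_, fun i hi => absurd hi (Nat.not_lt_zero _)⟩
        have : i = 0 := by omega
        subst this
        rw [e0, hz]
    · obtain ⟨h1, h2, h3, h4⟩ := ih ht0 (by omega)
      set acc := ((List.range t).zip (l.take t)).foldl
        (fun (acc : ℕ × ℕ) (q : ℕ × ℕ) => if decide (acc.2 < q.2) then q else acc) (0, 0) with hacc
      have et : l.getD t 0 = l[t]'(by omega) := List.getD_eq_getElem _ _ _
      by_cases hlt : acc.2 < l[t]'(by omega)
      · rw [if_pos (decide_eq_true hlt)]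
        refine ⟨Nat.lt_succ_self t, et.symm, fun i hi => ?_, fun i hi => ?_⟩
        · rcases Nat.lt_succ_iff_lt_or_eq.1 hi with hi | rfl
          · exact ((h3 i hi).trans hlt.le)
          · exact et.le
        · exact lt_of_le_of_lt (h3 i hi) hlt
      · rw [if_neg (by simpa using hlt)]
        refine ⟨Nat.lt_succ_of_lt h1, h2, fun i hi => ?_, h4⟩
        rcases Nat.lt_succ_iff_lt_or_eq.1 hi with hi | rfl
        · exact h3 i hi
        · rw [et]; exact Nat.le_of_not_lt hlt

/-- **Specification of the first argmax**: on a nonempty list it is an index of a maximal entry and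
every earlier entry is strictly smaller (so it is the LEAST index of a maximal entry). [folklore] -/
theorem firstArgmax_spec {l : List ℕ} (hl : l ≠ []) :
    firstArgmax l < l.length ∧ (∀ i < l.length, l.getD i 0 ≤ l.getD (firstArgmax l) 0) ∧
      (∀ i < firstArgmax l, l.getD i 0 < l.getD (firstArgmax l) 0) := by
  have hlen : 1 ≤ l.length := by
    rcases l with _ | ⟨a, l⟩
    · exact absurd rfl hl
    · simp
  have h := firstArgmax_fold_inv l l.length hlen le_rfl
  rw [List.take_length] at h
  obtain ⟨h1, h2, h3, h4⟩ := h
  unfold firstArgmax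
  exact ⟨h1, fun i hi => h2 ▸ h3 i hi, fun i hi => h2 ▸ h4 i hi⟩

/-! ### Chunking a list -/

/-- **Consecutive pieces of length `u`** (the incomplete tail dropped; `[]` for `u = 0`). [folklore] -/
def chunks {α : Type} (u : ℕ) (l : List α) : List (List α) := (List.range (l.length / u)).map fun i => (l.drop (i * u)).take u

/-- **Chunking on codes** (piece length in unary). [cite: AroraBarak2009, §1.3] -/
theorem codeFP_chunks {α : Type} (eα : α → List Bool) : CodeFP (pairE unE (rawE eα)) (rawE (rawE eα)) (fun p => chunks p.1 p.2) := by
  -- context `(1ᵘ, l)`, item `i` (binary): `take u (drop (min (i·u) |l|) l)`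
  have hu : CodeFP (pairE (pairE unE (rawE eα)) natE) unE (fun t => t.1.1) := (fst _ _).fst'
  have hl : CodeFP (pairE (pairE unE (rawE eα)) natE) (rawE eα) (fun t => t.1.2) := (fst _ _).snd'
  have hiu : CodeFP (pairE (pairE unE (rawE eα)) natE) natE (fun t => t.2 * t.1.1) :=
    natMul.comp ((snd _ _).pair (natOfUn.comp hu))
  have hpos : CodeFP (pairE (pairE unE (rawE eα)) natE) unE (fun t => min (t.2 * t.1.1) t.1.2.length) :=
    unOfNatMin.comp (((ulength eα).comp hl).pair hiu)
  have hitem : CodeFP (pairE (pairE unE (rawE eα)) natE) (rawE eα) (fun t => (t.1.2.drop (min (t.2 * t.1.1) t.1.2.length)).take t.1.1) :=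
    (rawTakeUn eα).comp (hu.pair ((rawDropUn eα).comp (hpos.pair hl)))
  have hk : CodeFP (pairE unE (rawE eα)) (rawE natE) (fun p => List.range (min (p.2.length / p.1) p.2.length)) :=
    rangeOf.comp (((ulength eα).comp (snd _ _)).pair (natDiv.comp (((natLength eα).comp (snd _ _)).pair (natOfUn.comp (fst _ _)))))
  refine ((map hitem).comp ((CodeFP.id _).pair hk)).congr fun p => ?_
  obtain ⟨u, l⟩ := p
  unfold chunks
  simp only [id_eq]
  rw [Nat.min_eq_left (Nat.div_le_self _ _)]
  refine List.map_congr_left fun i _ => ?_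
  congr 1
  rcases le_total (i * u) l.length with h | h
  · rw [Nat.min_eq_left h]
  · rw [Nat.min_eq_right h, List.drop_of_length_le h, List.drop_of_length_le le_rfl]

/-! ### A fixed polynomial, and `⌊log₂ n⌋ + 1` -/

/-- **Evaluating a FIXED polynomial with natural coefficients on codes.** [cite: AroraBarak2009, §1.3] -/
theorem codeFP_polyEval (p : Polynomial ℕ) : CodeFP natE natE (fun x => p.eval x) := by
  induction p using Polynomial.induction_on with
  | C a => exact (const natE a).congr fun x => by simp
  | add p q hp hq => exact (natAdd.comp (hp.pair hq)).congr fun x => by simp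
  | monomial k a h => exact (natMul.comp (h.pair (CodeFP.id natE))).congr fun x => by simp [pow_succ, mul_assoc]

/-- `⌊log₂ n⌋ + 1` as `max 1 |bin n|`. [folklore] -/
def logSucc (n : ℕ) : ℕ := max 1 (natE n).length

/-- `logSucc n = ⌊log₂ n⌋ + 1`. [folklore] -/
theorem logSucc_eq (n : ℕ) : logSucc n = Nat.log 2 n + 1 := by
  unfold logSucc
  change max 1 (encodeNat n).length = _
  rw [TM2Pass.length_encodeNat_eq_size]
  rcases Nat.eq_zero_or_pos n with rfl | hn
  · simp
  · have h1 : n.size ≤ Nat.log 2 n + 1 := Nat.size_le.2 (Nat.lt_pow_succ_log_self one_lt_two n)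
    have h2 : Nat.log 2 n < n.size := Nat.lt_size.2 (Nat.pow_log_le_self 2 hn.ne')
    omega

/-- **`⌊log₂ n⌋ + 1` on codes** (binary input). [cite: AroraBarak2009, §1.3] -/
theorem codeFP_logSucc : CodeFP natE natE logSucc :=
  (natMax.comp ((const _ 1).pair (strNatLength.comp strOfNat))).congr fun _ => rfl

end Prog

end MP12

end LWE

end Literature.Computability.Cryptography
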